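import Mathlib
import Literature.Barriers.FinalStateConjecture.NonSmoothNullInfinityRadius

/-!
# Route PhotonSphereChannels — the tortoise radius function and the Regge–Wheeler potential

Helper file for the linear items of route `PhotonSphereChannels` (`FixedModeChannels`,
stmt-FinalStateConjecture-10048; also `UniformPhotonSphereChannels`, `BlindnessInsidePhotonSphere`).
Those statements quantify over every `r : ℝ → ℝ` with `2M < r`, `r' = 1 − 2M/r` and `r xc = 3M`
(the areal radius along the Regge–Wheeler tortoise line, photon sphere at `xc`) and use the
Regge–Wheeler / spin-`s` potential
`V_{s,ℓ}(ρ) = (1 − 2M/ρ)(ℓ(ℓ+1)/ρ² + (1 − s²)·2M/ρ³)` evaluated at `ρ = r x`.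

This file records the elementary facts every proof of those items starts from:

* `tortoise_eq_efAreaRadius`: the `r`-hypotheses PIN `r` — it is the tree's Eddington–Finkelstein
  area radius `efAreaRadius M` (`Literature/Barriers/FinalStateConjecture/NonSmoothNullInfinityRadius`)
  translated so that `r xc = 3M` (ODE uniqueness, the field `y ↦ 1 − 2M/y` being Lipschitz on
  `y > 2M`); hence `r` is smooth and strictly increasing, `r x < 3M ↔ x < xc`, `r → ∞`;
* the horizon-side exponential law `efAreaRadius M x − 2M ≤ exp((x − 2M)/(2M))` and
  `1 − 2M/ρ ≤ (ρ − 2M)/(2M)`;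
* positivity `0 < V_{s,ℓ}(ρ)` for `ρ > 2M`, `s ≤ 2`, `s ≤ ℓ` (so the energy density of the items
  is a sum of non-negative terms and `ENNReal.ofReal` clips nothing), and the bounds
  `V_{s,ℓ}(ρ) ≤ (1 − 2M/ρ)(ℓ(ℓ+1) + 1)/ρ² ≤ (ℓ(ℓ+1) + 1)/ρ²`, whence the exponentially small
  horizon tail `V_{s,ℓ}(r x) ≤ (ℓ(ℓ+1)+1)/(2M)³ · exp((x − xc + r*(3M) − 2M)/(2M))`
  that makes the near (horizon-side) channel perturbative for `ρ ≥ ρ₀(M, ℓ) ≍ 4M log ℓ`.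

No new definitions (the potential is written out, as in the route file).
-/

namespace Summit.FinalStateConjecture.FinalStateConjecture.Theorems

open Literature.Barriers.FinalStateConjecture Real Set Filter Topology

/-! ### The `r`-hypotheses pin the tortoise radius function -/

section Tortoise

variable {M : ℝ} {r : ℝ → ℝ} {xc : ℝ}

/-- **Uniqueness of the tortoise radius function.** If `2M < r`, `r' = 1 − 2M/r` everywhere and
`r xc = 3M` (`M > 0`), then `r x = efAreaRadius M (x − xc + r*(3M))` with `r* = efTortoiseCoord M`:
the hypotheses of the route's linear items determine `r` as the translate of the tree's
Eddington–Finkelstein area radius putting the photon sphere at `xc`. Proof: both solve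
`y' = 1 − 2M/y` in `y > 2M`, where the field is Lipschitz (`lipschitzOnWith_efField`), with the
same value `3M` at `xc`; `ODE_solution_unique_univ`. -/
theorem tortoise_eq_efAreaRadius (hM : 0 < M) (hr : ∀ x, 2 * M < r x)
    (hr' : ∀ x, HasDerivAt r (1 - 2 * M / r x) x) (hxc : r xc = 3 * M) (x : ℝ) :
    r x = efAreaRadius M (x - xc + efTortoiseCoord M (3 * M)) := by
  set c : ℝ := efTortoiseCoord M (3 * M) - xc with hc
  have hmodel : ∀ y, HasDerivAt (fun y => efAreaRadius M (y + c))
      (1 - 2 * M / efAreaRadius M (y + c)) y := by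
    intro y
    have hlin : HasDerivAt (fun y : ℝ => y + c) 1 y := (hasDerivAt_id y).add_const c
    simpa [Function.comp_def] using (hasDerivAt_efAreaRadius hM (y + c)).comp y hlin
  have huniq := ODE_solution_unique_univ (v := fun _ y => 1 - 2 * M / y) (s := fun _ => Ioi (2 * M))
    (t₀ := xc) (f := r) (g := fun y => efAreaRadius M (y + c))
    (fun _ => lipschitzOnWith_efField hM) (fun y => ⟨hr' y, hr y⟩)
    (fun y => ⟨hmodel y, two_mul_lt_efAreaRadius hM _⟩) (by
      simp only [hc, add_sub_cancel, hxc]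
      exact (efAreaRadius_efTortoiseCoord hM (by linarith)).symm)
  have := congrFun huniq x
  simpa [hc, sub_eq_add_neg, add_assoc, add_comm, add_left_comm] using this

/-- The tortoise radius function, as a function: `r = efAreaRadius M ∘ (· − xc + r*(3M))`. -/
theorem tortoise_eq_efAreaRadius_fun (hM : 0 < M) (hr : ∀ x, 2 * M < r x)
    (hr' : ∀ x, HasDerivAt r (1 - 2 * M / r x) x) (hxc : r xc = 3 * M) :
    r = fun x => efAreaRadius M (x - xc + efTortoiseCoord M (3 * M)) :=
  funext (tortoise_eq_efAreaRadius hM hr hr' hxc)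

/-- The tortoise radius function is smooth (`C^n` for every `n : ℕ∞`). -/
theorem tortoise_contDiff (hM : 0 < M) (hr : ∀ x, 2 * M < r x)
    (hr' : ∀ x, HasDerivAt r (1 - 2 * M / r x) x) (hxc : r xc = 3 * M) (n : ℕ∞) :
    ContDiff ℝ n r := by
  rw [tortoise_eq_efAreaRadius_fun hM hr hr' hxc]
  have h := (contDiff_efAreaRadius hM).of_le (show (n : WithTop ℕ∞) ≤ ((⊤ : ℕ∞) : WithTop ℕ∞) by
    exact_mod_cast le_top)
  exact h.comp ((contDiff_id.sub contDiff_const).add contDiff_const)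

/-- The tortoise radius function is strictly increasing. -/
theorem tortoise_strictMono (hM : 0 < M) (hr : ∀ x, 2 * M < r x)
    (hr' : ∀ x, HasDerivAt r (1 - 2 * M / r x) x) (hxc : r xc = 3 * M) : StrictMono r := by
  rw [tortoise_eq_efAreaRadius_fun hM hr hr' hxc]
  exact (strictMono_efAreaRadius hM).comp (fun a b hab => by linarith)

/-- The photon sphere splits the tortoise line at `xc`: `r x < 3M ↔ x < xc`. -/
theorem tortoise_lt_three_mul_iff (hM : 0 < M) (hr : ∀ x, 2 * M < r x)
    (hr' : ∀ x, HasDerivAt r (1 - 2 * M / r x) x) (hxc : r xc = 3 * M) (x : ℝ) :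
    r x < 3 * M ↔ x < xc := by
  rw [← hxc]
  exact (tortoise_strictMono hM hr hr' hxc).lt_iff_lt

/-- `3M ≤ r x ↔ xc ≤ x`. -/
theorem three_mul_le_tortoise_iff (hM : 0 < M) (hr : ∀ x, 2 * M < r x)
    (hr' : ∀ x, HasDerivAt r (1 - 2 * M / r x) x) (hxc : r xc = 3 * M) (x : ℝ) :
    3 * M ≤ r x ↔ xc ≤ x := by
  rw [← hxc]
  exact (tortoise_strictMono hM hr hr' hxc).le_iff_le

/-- The tortoise radius function tends to `+∞` at `+∞`. -/
theorem tortoise_tendsto_atTop (hM : 0 < M) (hr : ∀ x, 2 * M < r x)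
    (hr' : ∀ x, HasDerivAt r (1 - 2 * M / r x) x) (hxc : r xc = 3 * M) :
    Tendsto r atTop atTop := by
  rw [tortoise_eq_efAreaRadius_fun hM hr hr' hxc]
  exact (tendsto_efAreaRadius_atTop hM).comp
    (tendsto_atTop_add_const_right _ _ (tendsto_atTop_add_const_right _ _ tendsto_id))

/-- **Horizon-side exponential law** for the model: `efAreaRadius M x − 2M ≤ exp ((x − 2M)/(2M))`
(from `x = ρ + 2M log(ρ − 2M)` and `ρ − 2M > 0`). -/
theorem efAreaRadius_sub_le_exp (hM : 0 < M) (x : ℝ) :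
    efAreaRadius M x - 2 * M ≤ Real.exp ((x - 2 * M) / (2 * M)) := by
  set ρ := efAreaRadius M x with hρ
  have h2 : 2 * M < ρ := two_mul_lt_efAreaRadius hM x
  have hu : 0 < ρ - 2 * M := by linarith
  have hx : x = ρ + 2 * M * Real.log (ρ - 2 * M) := by
    rw [hρ, ← efTortoiseCoord, efTortoiseCoord_efAreaRadius hM x]
  have hlog : Real.log (ρ - 2 * M) ≤ (x - 2 * M) / (2 * M) := by
    rw [le_div_iff₀ (by positivity)]
    nlinarith
  calc ρ - 2 * M = Real.exp (Real.log (ρ - 2 * M)) := (Real.exp_log hu).symm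
    _ ≤ Real.exp ((x - 2 * M) / (2 * M)) := Real.exp_le_exp.2 hlog

/-- The redshift factor is controlled by the distance to the horizon radius:
`1 − 2M/ρ ≤ (ρ − 2M)/(2M)` for `ρ ≥ 2M > 0`. -/
theorem one_sub_div_le_sub_div (hM : 0 < M) {ρ : ℝ} (hρ : 2 * M ≤ ρ) :
    1 - 2 * M / ρ ≤ (ρ - 2 * M) / (2 * M) := by
  have h2M : 0 < 2 * M := by positivity
  have hρ0 : 0 < ρ := lt_of_lt_of_le h2M hρ
  have heq : 1 - 2 * M / ρ = (ρ - 2 * M) / ρ := by field_simp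
  rw [heq]
  exact div_le_div_of_nonneg_left (by linarith) h2M hρ

end Tortoise

/-! ### The Regge–Wheeler potential: sign and size -/

section Potential

variable {M ρ : ℝ} {s ℓ : ℕ}

/-- **Positivity of the Regge–Wheeler potential.** For `ρ > 2M > 0`, `s ≤ 2` and `s ≤ ℓ`,
`0 < (1 − 2M/ρ)(ℓ(ℓ+1)/ρ² + (1 − s²)·2M/ρ³)`: for `s ≤ 1` both summands are `≥ 0` and one is
positive; for `s = 2`, `ℓ(ℓ+1)ρ ≥ 6ρ > 12M > 6M`. Consequently the energy density
`ψ_t² + ψ_x² + Vψ²` of the route's linear items is non-negative. -/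
theorem rwPotential_pos (hM : 0 < M) (hρ : 2 * M < ρ) (hs : s ≤ 2) (hsℓ : s ≤ ℓ) :
    0 < (1 - 2 * M / ρ) * ((ℓ : ℝ) * ((ℓ : ℝ) + 1) / ρ ^ 2 + (1 - (s : ℝ) ^ 2) * (2 * M) / ρ ^ 3) := by
  have hρ0 : 0 < ρ := lt_trans (by positivity) hρ
  have hred : 0 < 1 - 2 * M / ρ := by
    rw [sub_pos, div_lt_one hρ0]; exact hρ
  refine mul_pos hred ?_
  have hL : (0 : ℝ) ≤ (ℓ : ℝ) * ((ℓ : ℝ) + 1) * ρ := by positivity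
  have key : 0 < (ℓ : ℝ) * ((ℓ : ℝ) + 1) * ρ + (1 - (s : ℝ) ^ 2) * (2 * M) := by
    interval_cases s
    · norm_num
      nlinarith
    · have hℓ : (1 : ℝ) ≤ ℓ := by exact_mod_cast hsℓ
      norm_num
      have : 0 < (ℓ : ℝ) * ((ℓ : ℝ) + 1) := by nlinarith
      positivity
    · have hℓ : (2 : ℝ) ≤ ℓ := by exact_mod_cast hsℓ
      have h6 : (6 : ℝ) ≤ (ℓ : ℝ) * ((ℓ : ℝ) + 1) := by nlinarith
      have h6ρ : 6 * ρ ≤ (ℓ : ℝ) * ((ℓ : ℝ) + 1) * ρ := mul_le_mul_of_nonneg_right h6 hρ0.le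
      norm_num
      nlinarith
  have heq : (ℓ : ℝ) * ((ℓ : ℝ) + 1) / ρ ^ 2 + (1 - (s : ℝ) ^ 2) * (2 * M) / ρ ^ 3
      = ((ℓ : ℝ) * ((ℓ : ℝ) + 1) * ρ + (1 - (s : ℝ) ^ 2) * (2 * M)) / ρ ^ 3 := by
    field_simp
  rw [heq]
  positivity

/-- Non-negativity of the Regge–Wheeler potential (`ρ > 2M > 0`, `s ≤ 2`, `s ≤ ℓ`). -/
theorem rwPotential_nonneg (hM : 0 < M) (hρ : 2 * M < ρ) (hs : s ≤ 2) (hsℓ : s ≤ ℓ) :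
    0 ≤ (1 - 2 * M / ρ) * ((ℓ : ℝ) * ((ℓ : ℝ) + 1) / ρ ^ 2 + (1 - (s : ℝ) ^ 2) * (2 * M) / ρ ^ 3) :=
  (rwPotential_pos hM hρ hs hsℓ).le

/-- **Size of the Regge–Wheeler potential**: for `ρ > 2M > 0` (any `s, ℓ`),
`V_{s,ℓ}(ρ) ≤ (1 − 2M/ρ)(ℓ(ℓ+1) + 1)/ρ²` (since `(1 − s²)·2M/ρ³ ≤ 2M/ρ³ < 1/ρ²`). -/
theorem rwPotential_le (hM : 0 < M) (hρ : 2 * M < ρ) :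
    (1 - 2 * M / ρ) * ((ℓ : ℝ) * ((ℓ : ℝ) + 1) / ρ ^ 2 + (1 - (s : ℝ) ^ 2) * (2 * M) / ρ ^ 3)
      ≤ (1 - 2 * M / ρ) * (((ℓ : ℝ) * ((ℓ : ℝ) + 1) + 1) / ρ ^ 2) := by
  have hρ0 : 0 < ρ := lt_trans (by positivity) hρ
  have hred : 0 ≤ 1 - 2 * M / ρ := by
    rw [sub_nonneg, div_le_one hρ0]; exact hρ.le
  refine mul_le_mul_of_nonneg_left ?_ hred
  have h1 : (1 - (s : ℝ) ^ 2) * (2 * M) / ρ ^ 3 ≤ 1 / ρ ^ 2 := by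
    rw [div_le_div_iff₀ (by positivity) (by positivity)]
    have hs0 : (0 : ℝ) ≤ (s : ℝ) ^ 2 := by positivity
    nlinarith [mul_nonneg hs0 (by positivity : (0 : ℝ) ≤ 2 * M * ρ ^ 2)]
  have : ((ℓ : ℝ) * ((ℓ : ℝ) + 1) + 1) / ρ ^ 2 = (ℓ : ℝ) * ((ℓ : ℝ) + 1) / ρ ^ 2 + 1 / ρ ^ 2 := by
    ring
  rw [this]
  linarith

/-- Coarser bound without the redshift factor: `V_{s,ℓ}(ρ) ≤ (ℓ(ℓ+1) + 1)/ρ²` (`ρ > 2M > 0`). -/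
theorem rwPotential_le_div_sq (hM : 0 < M) (hρ : 2 * M < ρ) :
    (1 - 2 * M / ρ) * ((ℓ : ℝ) * ((ℓ : ℝ) + 1) / ρ ^ 2 + (1 - (s : ℝ) ^ 2) * (2 * M) / ρ ^ 3)
      ≤ ((ℓ : ℝ) * ((ℓ : ℝ) + 1) + 1) / ρ ^ 2 := by
  have hρ0 : 0 < ρ := lt_trans (by positivity) hρ
  refine (rwPotential_le hM hρ).trans ?_
  have hred1 : 1 - 2 * M / ρ ≤ 1 := by
    have := div_nonneg (by positivity : (0 : ℝ) ≤ 2 * M) hρ0.le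
    linarith
  have hq : 0 ≤ ((ℓ : ℝ) * ((ℓ : ℝ) + 1) + 1) / ρ ^ 2 := by positivity
  nlinarith

/-- **Exponentially small horizon tail of the potential (model coordinate).** For `M > 0` and every
`x`, with `ρ = efAreaRadius M x`:
`V_{s,ℓ}(ρ) ≤ (ℓ(ℓ+1) + 1)/(2M)³ · exp((x − 2M)/(2M))` — the redshift factor is
`≤ (ρ − 2M)/(2M) ≤ exp((x − 2M)/(2M))/(2M)` and `1/ρ² < 1/(2M)²`. This is the `O(e^{x/2M})` decay of
the Regge–Wheeler potential towards the horizon end `x → −∞` of the tortoise line. -/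
theorem rwPotential_efAreaRadius_le_exp (hM : 0 < M) (x : ℝ) :
    (1 - 2 * M / efAreaRadius M x) * ((ℓ : ℝ) * ((ℓ : ℝ) + 1) / efAreaRadius M x ^ 2
        + (1 - (s : ℝ) ^ 2) * (2 * M) / efAreaRadius M x ^ 3)
      ≤ ((ℓ : ℝ) * ((ℓ : ℝ) + 1) + 1) / (2 * M) ^ 3 * Real.exp ((x - 2 * M) / (2 * M)) := by
  set ρ := efAreaRadius M x with hρ
  have h2 : 2 * M < ρ := two_mul_lt_efAreaRadius hM x
  have h2M : 0 < 2 * M := by positivity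
  have hL : 0 ≤ (ℓ : ℝ) * ((ℓ : ℝ) + 1) + 1 := by positivity
  refine (rwPotential_le hM h2).trans ?_
  have hred : 1 - 2 * M / ρ ≤ Real.exp ((x - 2 * M) / (2 * M)) / (2 * M) := by
    refine (one_sub_div_le_sub_div hM h2.le).trans ?_
    exact div_le_div_of_nonneg_right (efAreaRadius_sub_le_exp hM x) h2M.le
  have hsq : ((ℓ : ℝ) * ((ℓ : ℝ) + 1) + 1) / ρ ^ 2 ≤ ((ℓ : ℝ) * ((ℓ : ℝ) + 1) + 1) / (2 * M) ^ 2 := by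
    apply div_le_div_of_nonneg_left hL (by positivity)
    exact pow_le_pow_left₀ h2M.le h2.le 2
  have hred0 : 0 ≤ 1 - 2 * M / ρ := by
    rw [sub_nonneg, div_le_one (lt_trans h2M h2)]; exact h2.le
  calc (1 - 2 * M / ρ) * (((ℓ : ℝ) * ((ℓ : ℝ) + 1) + 1) / ρ ^ 2)
      ≤ (Real.exp ((x - 2 * M) / (2 * M)) / (2 * M)) * (((ℓ : ℝ) * ((ℓ : ℝ) + 1) + 1) / (2 * M) ^ 2) :=
        mul_le_mul hred hsq (by positivity) (by positivity)
    _ = ((ℓ : ℝ) * ((ℓ : ℝ) + 1) + 1) / (2 * M) ^ 3 * Real.exp ((x - 2 * M) / (2 * M)) := by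
        field_simp

end Potential

/-- **Exponentially small horizon tail of the potential, for any tortoise radius function.** Under the
`r`-hypotheses of the route's linear items (`2M < r`, `r' = 1 − 2M/r`, `r xc = 3M`, `M > 0`), for all
`s, ℓ` and all `x`:
`V_{s,ℓ}(r x) ≤ (ℓ(ℓ+1) + 1)/(2M)³ · exp((x − xc + r*(3M) − 2M)/(2M))`, `r* = efTortoiseCoord M`.
In particular `sup_{x < xc − ρ} V_{s,ℓ}(r x) = O_M(ℓ² e^{−ρ/2M})`, the smallness that drives the
near-channel estimate of `FixedModeChannels` for `ρ ≥ ρ₀(M, ℓ) ≍ 4M log ℓ`. -/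
theorem rwPotential_tortoise_le_exp {M : ℝ} {r : ℝ → ℝ} {xc : ℝ} (hM : 0 < M)
    (hr : ∀ x, 2 * M < r x) (hr' : ∀ x, HasDerivAt r (1 - 2 * M / r x) x) (hxc : r xc = 3 * M)
    (s ℓ : ℕ) (x : ℝ) :
    (1 - 2 * M / r x) * ((ℓ : ℝ) * ((ℓ : ℝ) + 1) / r x ^ 2 + (1 - (s : ℝ) ^ 2) * (2 * M) / r x ^ 3)
      ≤ ((ℓ : ℝ) * ((ℓ : ℝ) + 1) + 1) / (2 * M) ^ 3
          * Real.exp ((x - xc + efTortoiseCoord M (3 * M) - 2 * M) / (2 * M)) := by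
  rw [tortoise_eq_efAreaRadius hM hr hr' hxc x]
  exact rwPotential_efAreaRadius_le_exp hM _

end Summit.FinalStateConjecture.FinalStateConjecture.Theorems
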